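/-
Copyright: statement-level skeleton of a published paper (lit-balaban cell, Phase-2 proof seat p25, gen 19). No proof
claims beyond what the kernel checks below.
-/
import Literature.MathematicalPhysics.QuantumFieldTheory.BalabanImbrieJaffe1984to88.BIJ88WalkRemainderShape312
import Literature.MathematicalPhysics.QuantumFieldTheory.BalabanImbrieJaffe1984to88.BIJ88WalkTermNorm312

/-!
# `BalabanImbrieJaffe1984to88.BIJ88WalkRemainderSmall312` — T. Bałaban, J. Imbrie, A. Jaffe, *Effective action and
cluster properties of the abelian Higgs model*, Commun. Math. Phys. **114** (1988) 257–315 [BalabanImbrieJaffe1988],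
§5.14 p. 311–312 [PDF 55–56], verbatim: *"The components containing contractions to χ′_{Λ^{(k)}}, terms from the random
walk expansions, or at least m̄+1 interactions are called remainder components {X_r}."* (p. 311), *"The main source of
concern in estimating G_k(X_{r′}) is that we only have bounds |F_{k,loc}(X_{σ₁})| ≤ c(L^kε)^{−m(c)}e^{−m′(c)} coming from
our estimates on perturbation expansions of observables; similarly for F^L_{k+1,loc}(X_c). By performing sufficiently many
integrations by parts, we have arranged for enough small factors to beat these large factors in the remainder terms
(at least if X_{r′} is not at the boundary of Λ₁₂^{(k)})."* (p. 312), and p. 309 [PDF 53] on the `χ′` factors of the same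
expansion: *"Each t-derivative of a χ-factor in χ_{Λ₁₂^{(k)},t} gives at least a factor e^β(L^kε/ε₀)^{1/4−α}."* — **EVERY REMAINDER
COMPONENT CARRIES AN EXTRA SMALL FACTOR** (p25 gen 19; v1.1 docfix: «χ_{Λ₁₂^{(k)},t}», «Λ₁₂^{(k)}»,
«; similarly for F^L_{k+1,loc}» read off the x2 renders `lit-balaban-r16/renders/cmp114/original-p053-x2.png` /
`…-p056-x2.png`, declarations untouched): with the records of `BIJ88WalkRemainderRecords312` (a set-aside
component has a `χ′`-contraction, or `≥ M` vertices, or a random-walk piece; the `χ′`-directions of a term are exactly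
the `χ′`-contractions of its remainder components) and the refined currency of `BIJ88WalkRemainderShape312` (`θ_v` per
vertex, `θ_w` per walk piece), charging `η_χ` per `χ′`-direction (the size of one derivative of the cutoff, abstract)
gives, for every term of the expansion of a product of observables,
`|coef_t|·Π‖dirs_t‖·η_χ^{|dirs_t|} ≤ Π_{X_c} shape(X_c) · Π_{X_r} (shape(X_r) · s)`, `s = max(η_χ, θ_v^M, θ_w)`
(`expand_small_init`): the printed three factors AND one extra small factor `s` per remainder component; summed over
all terms in these units the total is again `≤ W^{Φ₀(K)}` (`expand_l1_small_le`), i.e. in units of one `θ` per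
uncovered cube and one `s` per remainder component `≤ W^{Φ₀(K)}·Π_{j∈K} B_ℓ^{|obs j|}` (`expand_l1_small_free_le`).
Whether `s` beats the large constants `B_ℓ^{|obs j|}` of the observables inside `X_r` is print's choice of `m̄` and
of the couplings — not made here.

statement-level skeleton of published theorems with citation tags; proofs where landed; nothing here is a claim
about the Yang–Mills mass gap

PDF held: `paper:balaban1988-cmp114-bij-abelian-higgs-effective-action` (journal page = PDF page + 256); p. 309–312 =
PDF 53–56 (`p0053.txt` L21–22, `p0055.txt` L35–38, `p0056.txt` L20–25 re-read this session, 2026-08-23).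

CITATION HEADER (lean-in-tree rule).  lit-balaban cell (HOME `run/shared/lean/pub/lit-balaban/`), Phase 2, seat p25
gen 19; row **C2.Claim@312** of `HOME/lit-balaban-r16/ROWS-C2-part2.md` (owner r16, referee ref-5; head
`BIJ88Sect5StatementsPart4.Ineq312` untouched — MEMBER of the row).  USED BY NAME, nothing restated:
`BIJ88WalkRemainderShape312.{sf, rshape, sf_nonneg, sf_le_one, sf_le_of_isRem, expand_rshape_init, expand_l1_rshape_le}`,
`BIJ88WalkRemainderRecords312.{expand_nw_init, expand_dirs_length_init, expand_groups_isRem_init}` (p25 gen 19),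
`BIJ88WalkTermNorm312.prod_shape_eq`, `BIJ88WalkActivityShape312.shape`, `BIJ88WalkGeometry311.cubes`,
`BIJ88WalkExpansion311.expand` (p25 gen 18), `BIJ88VertexComponents311.maxArity`.

## What is proved (0 `sorry`, standard axioms, no new `Prop` facts; theorems only)

* §1 `sf_mul_eta_le` (one remainder component: `sf X·η_χ^{nchi X} ≤ s`), `eta_pow_dirs_eq`, `prod_rshape_le_prod_shape`,
  **`groups_rshape_eta_le`** (`Π_{X_r} rshape X_r · η_χ^{|dirs t|} ≤ Π_{X_r} (shape X_r · s)`).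
* §2 **`expand_small_init`**, **`expand_l1_small_le`**, **`expand_l1_small_free_le`**.
HONEST SCOPE: (a) `η_χ`, `θ_v`, `θ_w` are free data (`η_χ` is charged per `χ′`-direction through the directions'
bookkeeping only — the Gaussian integral of the remainder components, where print's `χ′` factor
`e^β(L^kε/ε₀)^{1/4−α}` actually arises (p. 309), is NOT estimated here; the sequel feeds it in as a hypothesis on the
law); (b) locality abstract, constant `W^{Φ₀(K)}`; (c) contraction-graph components; (d) no `Ineq312` binder.  NOT summit
progress; NOT continuum; NOT Clay.  Imports `BIJ88WalkRemainderShape312`, `BIJ88WalkTermNorm312`; modifies nothing.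
-/

noncomputable section

namespace Literature.MathematicalPhysics.QuantumFieldTheory.BalabanImbrieJaffe1984to88.BIJ88WalkRemainderSmall312

open Classical Matrix Finset
open scoped BigOperators
open BIJ88VertexComponents311 (maxArity)
open BIJ88WalkRun311 BIJ88WalkGeometry311 BIJ88WalkExpansion311 BIJ88WalkActivityShape312 BIJ88WalkTermNorm312
  BIJ88WalkRemainderRecords312 BIJ88WalkRemainderShape312

variable {S : Type} [Fintype S] {ι : Type} [Fintype ι] {κ : Type} [LinearOrder κ] {P : Type} [Fintype P]
  {β : Type} [DecidableEq β]

variable {Cov : P → Matrix S S ℝ} {trig : P → Bool} {f : S → ℝ} {c : ι → ℝ} {legs : ι → List (S → ℝ)}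
  {obs : κ → List (S → ℝ)} {M : ℕ} {oc : κ → Finset β} {vc : ι → Finset β} {reg : P → Finset β}
  {Bl θ θv θw ηχ : ℝ}

/-! ## §1  One remainder component; the remainder components of one term -/

omit [LinearOrder κ] [DecidableEq β] in
/-- `Π_{a ∈ m} θ^{n a} = θ^{Σ_{a ∈ m} n a}` (bookkeeping). [folklore] -/
private theorem prod_map_pow_eq {α : Type} (m : Multiset α) (θ : ℝ) (n : α → ℕ) :
    (m.map fun a => θ ^ n a).prod = θ ^ (m.map n).sum := by
  induction m using Multiset.induction_on with
  | empty => simp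
  | cons a m ih => simp only [Multiset.map_cons, Multiset.prod_cons, Multiset.sum_cons, ih, pow_add]

omit [LinearOrder κ] [DecidableEq β] in
/-- `Π_{a ∈ m} f a ≤ B^{#m}` when `0 ≤ f ≤ B` on `m` (bookkeeping). [folklore] -/
private theorem prod_map_le_pow_card {α : Type} (m : Multiset α) {f : α → ℝ} {B : ℝ} (h0 : ∀ a ∈ m, 0 ≤ f a)
    (h : ∀ a ∈ m, f a ≤ B) : (m.map f).prod ≤ B ^ Multiset.card m := by
  have h1 := Multiset.prod_map_le_prod_map₀ f (fun _ => B) h0 h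
  rwa [Multiset.map_const', Multiset.prod_replicate] at h1

omit [Fintype S] [Fintype ι] [LinearOrder κ] [Fintype P] [DecidableEq β] in
/-- **ONE REMAINDER COMPONENT CARRIES THE EXTRA SMALL FACTOR `s = max(η_χ, θ_v^M, θ_w)`**: a `χ′`-contraction
(`η_χ` for one of its `nchi X ≥ 1` directions), or no `χ′`-contraction and then `≥ M` vertices or a walk piece
(`BIJ88WalkRemainderShape312.sf_le_of_isRem`). [cite: BalabanImbrieJaffe1988, §5.14 p.311–312] -/
theorem sf_mul_eta_le (hη0 : 0 ≤ ηχ) (hη1 : ηχ ≤ 1) (hθv : 0 ≤ θv) (hθv1 : θv ≤ 1) (hθw : 0 ≤ θw) (hθw1 : θw ≤ 1)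
    {g : WGrp S κ ι P} (hrem : g.IsRem M) (hnw : g.nw = g.pcs.countP (fun q => trig q = true)) :
    sf trig θv θw g * ηχ ^ g.nchi ≤ max ηχ (max (θv ^ M) θw) := by
  by_cases hchi : g.nchi = 0
  · rw [hchi, pow_zero, mul_one]
    exact (sf_le_of_isRem hθv hθv1 hθw hθw1 hrem hchi hnw).trans (le_max_right _ _)
  · calc sf trig θv θw g * ηχ ^ g.nchi ≤ 1 * ηχ ^ g.nchi :=
          mul_le_mul_of_nonneg_right (sf_le_one hθv hθv1 hθw hθw1 g) (pow_nonneg hη0 _)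
      _ ≤ ηχ ^ 1 := by rw [one_mul]; exact pow_le_pow_of_le_one hη0 hη1 (Nat.one_le_iff_ne_zero.2 hchi)
      _ ≤ _ := by rw [pow_one]; exact le_max_left _ _

/-- **The `χ′`-charge of a term distributes over its remainder components**: `η_χ^{|dirs t|} = Π_{X ∈ t.groups} η_χ^{nchi X}`
for `t ∈ expand 0 K` (`BIJ88WalkRemainderRecords312.expand_dirs_length_init`). [cite: BalabanImbrieJaffe1988, §5.14 p.311] -/
theorem eta_pow_dirs_eq (ηχ : ℝ) (K : Finset κ) : ∀ t ∈ expand Cov trig f c legs obs M 0 K,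
    ηχ ^ t.dirs.length = (t.groups.map fun X => ηχ ^ X.nchi).prod := by
  intro t ht
  rw [expand_dirs_length_init K t ht, prod_map_pow_eq]

omit [Fintype S] [Fintype ι] [LinearOrder κ] [Fintype P] in
/-- Blocks in the refined currency are at most blocks in the printed currency (`sf ≤ 1`).
[cite: BalabanImbrieJaffe1988, §5.14 p.312] -/
theorem prod_rshape_le_prod_shape (hθ0 : 0 < θ) (hBl : 1 ≤ Bl) (hθv : 0 ≤ θv) (hθv1 : θv ≤ 1) (hθw : 0 ≤ θw)
    (hθw1 : θw ≤ 1) (m : Multiset (WGrp S κ ι P)) :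
    (m.map (rshape trig θv θw obs oc vc reg Bl θ)).prod ≤ (m.map (shape obs oc vc reg Bl θ)).prod := by
  refine Multiset.prod_map_le_prod_map₀ _ _ (fun g _ => ?_) fun g _ => ?_
  · exact mul_nonneg (mul_nonneg (prod_nonneg fun j _ => pow_nonneg (zero_le_one.trans hBl) _) (pow_nonneg hθ0.le _))
      (sf_nonneg hθv hθw g)
  · exact mul_le_of_le_one_right (mul_nonneg (prod_nonneg fun j _ => pow_nonneg (zero_le_one.trans hBl) _)
      (pow_nonneg hθ0.le _)) (sf_le_one hθv hθv1 hθw hθw1 g)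

/-- **THE REMAINDER COMPONENTS OF ONE TERM, WITH THE `χ′`-CHARGE, CARRY ONE EXTRA SMALL FACTOR EACH**: for
`t ∈ expand 0 K`, `Π_{X ∈ t.groups} rshape X · η_χ^{|dirs t|} ≤ Π_{X ∈ t.groups} (shape X · s)`, `s = max(η_χ, θ_v^M, θ_w)`.
[cite: BalabanImbrieJaffe1988, §5.14 p.311–312] -/
theorem groups_rshape_eta_le (hθ0 : 0 < θ) (hBl : 1 ≤ Bl) (hη0 : 0 ≤ ηχ) (hη1 : ηχ ≤ 1) (hθv : 0 ≤ θv) (hθv1 : θv ≤ 1)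
    (hθw : 0 ≤ θw) (hθw1 : θw ≤ 1) (K : Finset κ) : ∀ t ∈ expand Cov trig f c legs obs M 0 K,
    (t.groups.map (rshape trig θv θw obs oc vc reg Bl θ)).prod * ηχ ^ t.dirs.length
      ≤ (t.groups.map fun X => shape obs oc vc reg Bl θ X * max ηχ (max (θv ^ M) θw)).prod := by
  intro t ht
  rw [eta_pow_dirs_eq (Cov := Cov) (trig := trig) (f := f) (c := c) (legs := legs) (obs := obs) (M := M) ηχ K t ht,
    ← Multiset.prod_map_mul]
  refine Multiset.prod_map_le_prod_map₀ _ _ (fun X _ => ?_) fun X hX => ?_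
  · exact mul_nonneg (mul_nonneg (mul_nonneg (prod_nonneg fun j _ => pow_nonneg (zero_le_one.trans hBl) _)
      (pow_nonneg hθ0.le _)) (sf_nonneg hθv hθw X)) (pow_nonneg hη0 _)
  · rw [rshape, mul_assoc]
    exact mul_le_mul_of_nonneg_left
      (sf_mul_eta_le hη0 hη1 hθv hθv1 hθw hθw1 (expand_groups_isRem_init K t ht X hX)
        (expand_nw_init K t ht X (Multiset.mem_add.2 (Or.inr hX))))
      (mul_nonneg (prod_nonneg fun j _ => pow_nonneg (zero_le_one.trans hBl) _) (pow_nonneg hθ0.le _))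

/-! ## §2  Every term; the ℓ¹ norms -/

/-- **EVERY TERM: THE PRINTED THREE FACTORS AND ONE EXTRA SMALL FACTOR PER REMAINDER COMPONENT**: under the bracket /
coupling hypotheses of `BIJ88WalkWeights312.run_weight` and the refined currency hypotheses of
`BIJ88WalkRemainderShape312.wt_le_rshape` (`θ_v, θ_w ∈ [0,1]`), charging `η_χ ∈ [0,1]` per `χ′`-direction, every term
`t` of `expand 0 K` satisfies
`|coef_t|·Π_{z∈dirs_t}‖z‖·η_χ^{|dirs_t|} ≤ Π_{X ∈ t.consts} shape X · Π_{X ∈ t.groups} (shape X · max(η_χ, θ_v^M, θ_w))`.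
[cite: BalabanImbrieJaffe1988, §5.14 p.311–312] -/
theorem expand_small_init {Dir : Set (S → ℝ)} {B : P → ℝ} {cV : ι → ℝ} (hθ0 : 0 < θ) (hθ1 : θ ≤ 1) (hBl : 1 ≤ Bl)
    (hB0 : ∀ p, 0 ≤ B p) (hcV0 : ∀ m, 0 ≤ cV m) (hη0 : 0 ≤ ηχ) (hη1 : ηχ ≤ 1) (hθv : 0 ≤ θv) (hθv1 : θv ≤ 1)
    (hθw : 0 ≤ θw) (hθw1 : θw ≤ 1)
    (hB : ∀ p, ∀ u ∈ Dir, ∀ w ∈ Dir, |(Cov p *ᵥ u) ⬝ᵥ w| ≤ B p)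
    (hBf : ∀ p, ∀ u ∈ Dir, |(Cov p *ᵥ u) ⬝ᵥ f| ≤ B p) (hBz : ∀ p, ∀ u ∈ Dir, ‖Cov p *ᵥ u‖ ≤ B p)
    (hcV : ∀ m, |c m| ≤ cV m) (hobs : ∀ j, ∀ w ∈ obs j, w ∈ Dir) (hlegs : ∀ m, ∀ w ∈ legs m, w ∈ Dir)
    (hloc : ∀ p, trig p = false → B p ≤ Bl ∧ reg p = ∅) (hwalk : ∀ p, trig p = true → B p ≤ θw * θ ^ (reg p).card)
    (hvert : ∀ m, cV m * Bl ^ (legs m).length ≤ θv * θ ^ (vc m).card) (K : Finset κ) :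
    ∀ t ∈ expand Cov trig f c legs obs M 0 K,
      |t.coef| * (t.dirs.map fun z => ‖z‖).prod * ηχ ^ t.dirs.length
        ≤ (t.consts.map (shape obs oc vc reg Bl θ)).prod
          * (t.groups.map fun X => shape obs oc vc reg Bl θ X * max ηχ (max (θv ^ M) θw)).prod := by
  intro t ht
  have h1 := expand_rshape_init (oc := oc) (vc := vc) (reg := reg) (M := M) hθ0 hθ1 hBl hB0 hcV0 hθv hθw hB hBf hBz
    hcV hobs hlegs hloc hwalk hvert K t ht
  rw [Multiset.map_add, Multiset.prod_add] at h1
  have hc := prod_rshape_le_prod_shape (trig := trig) (obs := obs) (oc := oc) (vc := vc) (reg := reg) hθ0 hBl hθv hθv1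
    hθw hθw1 t.consts
  have hg := groups_rshape_eta_le (Cov := Cov) (trig := trig) (f := f) (c := c) (legs := legs) (obs := obs) (oc := oc)
    (vc := vc) (reg := reg) hθ0 hBl hη0 hη1 hθv hθv1 hθw hθw1 K t ht
  have hr0 : ∀ m : Multiset (WGrp S κ ι P), 0 ≤ (m.map (rshape trig θv θw obs oc vc reg Bl θ)).prod := fun m =>
    Multiset.prod_nonneg fun x hx => by
      obtain ⟨g, -, rfl⟩ := Multiset.mem_map.1 hx
      exact mul_nonneg (mul_nonneg (prod_nonneg fun j _ => pow_nonneg (zero_le_one.trans hBl) _) (pow_nonneg hθ0.le _))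
        (sf_nonneg hθv hθw g)
  have hs0 : 0 ≤ (t.consts.map (shape obs oc vc reg Bl θ)).prod :=
    Multiset.prod_nonneg fun x hx => by
      obtain ⟨g, -, rfl⟩ := Multiset.mem_map.1 hx
      exact mul_nonneg (prod_nonneg fun j _ => pow_nonneg (zero_le_one.trans hBl) _) (pow_nonneg hθ0.le _)
  calc |t.coef| * (t.dirs.map fun z => ‖z‖).prod * ηχ ^ t.dirs.length
      ≤ (t.consts.map (rshape trig θv θw obs oc vc reg Bl θ)).prod
          * (t.groups.map (rshape trig θv θw obs oc vc reg Bl θ)).prod * ηχ ^ t.dirs.length :=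
        mul_le_mul_of_nonneg_right h1 (pow_nonneg hη0 _)
    _ = (t.consts.map (rshape trig θv θw obs oc vc reg Bl θ)).prod
          * ((t.groups.map (rshape trig θv θw obs oc vc reg Bl θ)).prod * ηχ ^ t.dirs.length) := mul_assoc _ _ _
    _ ≤ _ := mul_le_mul hc hg (mul_nonneg (hr0 _) (pow_nonneg hη0 _)) hs0

/-- **THE ℓ¹ NORM IN UNITS OF THE PRINTED SHAPE AND ONE SMALL FACTOR PER REMAINDER COMPONENT**: under the hypotheses of
`BIJ88WalkRemainderShape312.expand_l1_rshape_le` (`0 < θ_v, θ_w ≤ 1`) and `η_χ ∈ [0,1]`,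
`Σ_{t ∈ expand 0 K} |coef_t|·Π‖dirs_t‖·η_χ^{|dirs_t|} / (Π_{X_c} shape X_c · Π_{X_r} (shape X_r · s)) ≤ W^{Φ₀(K)}`,
`s = max(η_χ, θ_v^M, θ_w)`. [cite: BalabanImbrieJaffe1988, §5.14 p.312] -/
theorem expand_l1_small_le {Dir : Set (S → ℝ)} {B' ρ : P → ℝ} {cV : ι → ℝ} {ρ₀ W : ℝ} {N₀ : ℕ}
    (hθ0 : 0 < θ) (hθ1 : θ ≤ 1) (hBl : 1 ≤ Bl) (hB0 : ∀ p, 0 ≤ B' p) (hρ : ∀ p, 0 ≤ ρ p) (hcV0 : ∀ m, 0 ≤ cV m)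
    (hη0 : 0 ≤ ηχ) (hη1 : ηχ ≤ 1) (hθv : 0 < θv) (hθv1 : θv ≤ 1) (hθw : 0 < θw) (hθw1 : θw ≤ 1)
    (hB : ∀ p, ∀ u ∈ Dir, ∀ w ∈ Dir, |(Cov p *ᵥ u) ⬝ᵥ w| ≤ B' p * ρ p)
    (hBf : ∀ p, ∀ u ∈ Dir, |(Cov p *ᵥ u) ⬝ᵥ f| ≤ B' p * ρ p) (hBz : ∀ p, ∀ u ∈ Dir, ‖Cov p *ᵥ u‖ ≤ B' p * ρ p)
    (hcV : ∀ m, |c m| ≤ cV m) (hobs : ∀ j, ∀ w ∈ obs j, w ∈ Dir) (hlegs : ∀ m, ∀ w ∈ legs m, w ∈ Dir)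
    (hloc : ∀ p, trig p = false → B' p ≤ Bl ∧ reg p = ∅) (hwalk : ∀ p, trig p = true → B' p ≤ θw * θ ^ (reg p).card)
    (hvert : ∀ m, cV m * Bl ^ (legs m).length ≤ θv * θ ^ (vc m).card) (hρ₀0 : 0 ≤ ρ₀)
    (hρ₀ : ∀ u ∈ Dir, (∑ p ∈ univ.filter (fun p => Cov p *ᵥ u ≠ 0), ρ p) ≤ ρ₀)
    (hN : ∀ p, ∀ u ∈ Dir,
      (∑ m, ((range (legs m).length).filter fun j => (Cov p *ᵥ u) ⬝ᵥ (legs m).getD j 0 ≠ 0).card) ≤ N₀)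
    (K : Finset κ) (hW1 : 1 ≤ W)
    (hW : ρ₀ * ((∑ j ∈ K, ((obs j).length + 1 + M * maxArity legs) + N₀ : ℕ) : ℝ) ≤ W) :
    ((expand Cov trig f c legs obs M 0 K).map fun t =>
        |t.coef| * (t.dirs.map fun z => ‖z‖).prod * ηχ ^ t.dirs.length
          / ((t.consts.map (shape obs oc vc reg Bl θ)).prod
              * (t.groups.map fun X => shape obs oc vc reg Bl θ X * max ηχ (max (θv ^ M) θw)).prod)).sum
      ≤ W ^ ∑ j ∈ K, ((obs j).length + 1 + M * maxArity legs) := by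
  have h := expand_l1_rshape_le (oc := oc) (vc := vc) (reg := reg) hθ0 hθ1 hBl hB0 hρ hcV0 hθv hθw hB hBf hBz hcV hobs
    hlegs hloc hwalk hvert hρ₀0 hρ₀ hN K hW1 hW
  refine le_trans (Multiset.sum_map_le_sum_map _ _ fun t ht => ?_) h
  have hsh0 : ∀ g : WGrp S κ ι P, 0 < shape obs oc vc reg Bl θ g := fun g =>
    mul_pos (prod_pos fun j _ => pow_pos (zero_lt_one.trans_le hBl) _) (pow_pos hθ0 _)
  have hs0 : 0 < max ηχ (max (θv ^ M) θw) := lt_max_of_lt_right (lt_max_of_lt_right hθw)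
  have hR : 0 < ((t.consts + t.groups).map (rshape trig θv θw obs oc vc reg Bl θ)).prod :=
    Multiset.prod_pos fun x hx => by
      obtain ⟨g, -, rfl⟩ := Multiset.mem_map.1 hx
      exact mul_pos (hsh0 g) (mul_pos (pow_pos hθv _) (pow_pos hθw _))
  have hA : 0 < (t.consts.map (shape obs oc vc reg Bl θ)).prod
      * (t.groups.map fun X => shape obs oc vc reg Bl θ X * max ηχ (max (θv ^ M) θw)).prod :=
    mul_pos (Multiset.prod_pos fun x hx => by obtain ⟨g, -, rfl⟩ := Multiset.mem_map.1 hx; exact hsh0 g)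
      (Multiset.prod_pos fun x hx => by obtain ⟨g, -, rfl⟩ := Multiset.mem_map.1 hx; exact mul_pos (hsh0 g) hs0)
  have ha0 : 0 ≤ |t.coef| * (t.dirs.map fun z => ‖z‖).prod :=
    mul_nonneg (abs_nonneg _) (List.prod_nonneg fun x hx => by
      obtain ⟨z, -, rfl⟩ := List.mem_map.1 hx; exact norm_nonneg z)
  rw [div_le_div_iff₀ hA hR]
  have key : ηχ ^ t.dirs.length * ((t.consts + t.groups).map (rshape trig θv θw obs oc vc reg Bl θ)).prod
      ≤ (t.consts.map (shape obs oc vc reg Bl θ)).prod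
          * (t.groups.map fun X => shape obs oc vc reg Bl θ X * max ηχ (max (θv ^ M) θw)).prod := by
    rw [Multiset.map_add, Multiset.prod_add]
    have hc := prod_rshape_le_prod_shape (trig := trig) (obs := obs) (oc := oc) (vc := vc) (reg := reg) hθ0 hBl hθv.le
      hθv1 hθw.le hθw1 t.consts
    have hg := groups_rshape_eta_le (Cov := Cov) (trig := trig) (f := f) (c := c) (legs := legs) (obs := obs)
      (oc := oc) (vc := vc) (reg := reg) hθ0 hBl hη0 hη1 hθv.le hθv1 hθw.le hθw1 K t ht
    have hr0 : ∀ m : Multiset (WGrp S κ ι P), 0 ≤ (m.map (rshape trig θv θw obs oc vc reg Bl θ)).prod := fun m =>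
      Multiset.prod_nonneg fun x hx => by
        obtain ⟨g, -, rfl⟩ := Multiset.mem_map.1 hx
        exact mul_nonneg (hsh0 g).le (sf_nonneg hθv.le hθw.le g)
    calc ηχ ^ t.dirs.length * ((t.consts.map (rshape trig θv θw obs oc vc reg Bl θ)).prod
            * (t.groups.map (rshape trig θv θw obs oc vc reg Bl θ)).prod)
        = (t.consts.map (rshape trig θv θw obs oc vc reg Bl θ)).prod
            * ((t.groups.map (rshape trig θv θw obs oc vc reg Bl θ)).prod * ηχ ^ t.dirs.length) := by ring
      _ ≤ _ := mul_le_mul hc hg (mul_nonneg (hr0 _) (pow_nonneg hη0 _))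
            (Multiset.prod_nonneg fun x hx => by obtain ⟨g, -, rfl⟩ := Multiset.mem_map.1 hx; exact (hsh0 g).le)
  calc |t.coef| * (t.dirs.map fun z => ‖z‖).prod * ηχ ^ t.dirs.length
          * ((t.consts + t.groups).map (rshape trig θv θw obs oc vc reg Bl θ)).prod
      = |t.coef| * (t.dirs.map fun z => ‖z‖).prod
          * (ηχ ^ t.dirs.length * ((t.consts + t.groups).map (rshape trig θv θw obs oc vc reg Bl θ)).prod) := by ring
    _ ≤ _ := mul_le_mul_of_nonneg_left key ha0

omit [Fintype S] [Fintype ι] [LinearOrder κ] [Fintype P] in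
/-- `Π_{X ∈ m} (shape X · s) = Π_{X ∈ m} shape X · s^{#m}` (bookkeeping). [folklore] -/
private theorem prod_map_shape_mul (s : ℝ) (m : Multiset (WGrp S κ ι P)) :
    (m.map fun X => shape obs oc vc reg Bl θ X * s).prod = (m.map (shape obs oc vc reg Bl θ)).prod * s ^ Multiset.card m := by
  rw [Multiset.prod_map_mul, Multiset.map_const', Multiset.prod_replicate]

/-- **ALL TERMS, SIZED IN UNITS OF ONE SMALL FACTOR PER UNCOVERED CUBE AND ONE PER REMAINDER COMPONENT**: under the
hypotheses of `expand_l1_small_le`,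
`Σ_{t ∈ expand 0 K} |coef_t|·Π‖dirs_t‖·η_χ^{|dirs_t|} · θ^{−Σ_X #(cubes X ∖ obs cubes of X)} · s^{−#t.groups} ≤ W^{Φ₀(K)} · Π_{j∈K} B_ℓ^{|obs j|}`
(`s = max(η_χ, θ_v^M, θ_w)`): print's large constant per observable, small factor per uncovered cube, and — beyond
gen 18's `BIJ88WalkTermNorm312.expand_l1_free_le` — one extra small factor per remainder component, uniformly in the
volume. [cite: BalabanImbrieJaffe1988, §5.14 p.312] -/
theorem expand_l1_small_free_le {Dir : Set (S → ℝ)} {B' ρ : P → ℝ} {cV : ι → ℝ} {ρ₀ W : ℝ} {N₀ : ℕ}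
    (hθ0 : 0 < θ) (hθ1 : θ ≤ 1) (hBl : 1 ≤ Bl) (hB0 : ∀ p, 0 ≤ B' p) (hρ : ∀ p, 0 ≤ ρ p) (hcV0 : ∀ m, 0 ≤ cV m)
    (hη0 : 0 ≤ ηχ) (hη1 : ηχ ≤ 1) (hθv : 0 < θv) (hθv1 : θv ≤ 1) (hθw : 0 < θw) (hθw1 : θw ≤ 1)
    (hB : ∀ p, ∀ u ∈ Dir, ∀ w ∈ Dir, |(Cov p *ᵥ u) ⬝ᵥ w| ≤ B' p * ρ p)
    (hBf : ∀ p, ∀ u ∈ Dir, |(Cov p *ᵥ u) ⬝ᵥ f| ≤ B' p * ρ p) (hBz : ∀ p, ∀ u ∈ Dir, ‖Cov p *ᵥ u‖ ≤ B' p * ρ p)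
    (hcV : ∀ m, |c m| ≤ cV m) (hobs : ∀ j, ∀ w ∈ obs j, w ∈ Dir) (hlegs : ∀ m, ∀ w ∈ legs m, w ∈ Dir)
    (hloc : ∀ p, trig p = false → B' p ≤ Bl ∧ reg p = ∅) (hwalk : ∀ p, trig p = true → B' p ≤ θw * θ ^ (reg p).card)
    (hvert : ∀ m, cV m * Bl ^ (legs m).length ≤ θv * θ ^ (vc m).card) (hρ₀0 : 0 ≤ ρ₀)
    (hρ₀ : ∀ u ∈ Dir, (∑ p ∈ univ.filter (fun p => Cov p *ᵥ u ≠ 0), ρ p) ≤ ρ₀)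
    (hN : ∀ p, ∀ u ∈ Dir,
      (∑ m, ((range (legs m).length).filter fun j => (Cov p *ᵥ u) ⬝ᵥ (legs m).getD j 0 ≠ 0).card) ≤ N₀)
    (K : Finset κ) (hW1 : 1 ≤ W)
    (hW : ρ₀ * ((∑ j ∈ K, ((obs j).length + 1 + M * maxArity legs) + N₀ : ℕ) : ℝ) ≤ W) :
    ((expand Cov trig f c legs obs M 0 K).map fun t =>
        |t.coef| * (t.dirs.map fun z => ‖z‖).prod * ηχ ^ t.dirs.length
          * (θ ^ ((t.consts + t.groups).map fun X => (cubes oc vc reg X \ X.lab.biUnion oc).card).sum)⁻¹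
          * ((max ηχ (max (θv ^ M) θw)) ^ Multiset.card t.groups)⁻¹).sum
      ≤ W ^ (∑ j ∈ K, ((obs j).length + 1 + M * maxArity legs)) * ∏ j ∈ K, Bl ^ (obs j).length := by
  have hC : 0 < ∏ j ∈ K, Bl ^ (obs j).length := prod_pos fun j _ => pow_pos (zero_lt_one.trans_le hBl) _
  have hs0 : 0 < max ηχ (max (θv ^ M) θw) := lt_max_of_lt_right (lt_max_of_lt_right hθw)
  have h := expand_l1_small_le (oc := oc) (vc := vc) (reg := reg) hθ0 hθ1 hBl hB0 hρ hcV0 hη0 hη1 hθv hθv1 hθw hθw1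
    hB hBf hBz hcV hobs hlegs hloc hwalk hvert hρ₀0 hρ₀ hN K hW1 hW
  -- each summand is `(Π_j B_ℓ^{|obs j|})⁻¹ ·` the summand of `expand_l1_small_le`
  have e : ((expand Cov trig f c legs obs M 0 K).map fun t =>
        |t.coef| * (t.dirs.map fun z => ‖z‖).prod * ηχ ^ t.dirs.length
          * (θ ^ ((t.consts + t.groups).map fun X => (cubes oc vc reg X \ X.lab.biUnion oc).card).sum)⁻¹
          * ((max ηχ (max (θv ^ M) θw)) ^ Multiset.card t.groups)⁻¹)
      = (expand Cov trig f c legs obs M 0 K).map fun t => (∏ j ∈ K, Bl ^ (obs j).length)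
          * (|t.coef| * (t.dirs.map fun z => ‖z‖).prod * ηχ ^ t.dirs.length
            / ((t.consts.map (shape obs oc vc reg Bl θ)).prod
                * (t.groups.map fun X => shape obs oc vc reg Bl θ X * max ηχ (max (θv ^ M) θw)).prod)) := by
    refine Multiset.map_congr rfl fun t ht => ?_
    have hθs : 0 < θ ^ ((t.consts + t.groups).map fun X => (cubes oc vc reg X \ X.lab.biUnion oc).card).sum := pow_pos hθ0 _
    have hss : 0 < (max ηχ (max (θv ^ M) θw)) ^ Multiset.card t.groups := pow_pos hs0 _
    rw [prod_map_shape_mul, ← mul_assoc, ← Multiset.prod_add, ← Multiset.map_add,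
      prod_shape_eq (Cov := Cov) (trig := trig) (f := f) (c := c) (legs := legs) (M := M) Bl θ K t ht]
    field_simp
  rw [e, Multiset.sum_map_mul_left, mul_comm]
  exact mul_le_mul_of_nonneg_right h hC.le

end Literature.MathematicalPhysics.QuantumFieldTheory.BalabanImbrieJaffe1984to88.BIJ88WalkRemainderSmall312

end
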